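import Mathlib
import Summits.Ventures.PercRepro2.CoinChainXAGateBridge
import Summits.Ventures.PercRepro2.CoinChainXAGMFact
import Summits.Ventures.PercRepro2.CoinChainXAGR1Fact
import Summits.Ventures.PercRepro2.CoinChainXAGateCov

/-!
# Every admissible gate that is OPEN on the `m`-clusters satisfies (XA′) — the gate law's covariance about the world-0 means
(blind cell PercRepro2, night-2 g34; proofs/NIGHT2-DARC.md §74)

For `ent = {m}`, ANY `ent' ∋ j, j'`, the entry markers and ANY admissible gate `d'` with `d' = d` on the `m`-clusters
(its part on the coin-entered clusters `D'` arbitrary: `0 ≤ d' ≤ d`, `d'` log-supermodular, `d'/d` increasing), the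
cleared (XA′) holds.  Reason: with `d' = d` on `M` the coin-closed gate law `G⁰` is the world-0 law `R⁰`, so `Cross = 0`
and (XA′) is `0 ≤ L·U001(G¹)` — the covariance of the entry markers under the gate law `G¹ = (c on I, d' on D' ∪ M)` about
the world-0 means.  In the parts (`cg_mopen_parts`: the twelve of the chain plus the gate's four `D'` sums `wD, XWD, YWD,
XYWD`), with `L = a + δ + u + t`, `R_G = a + wD + t` (the gate law's mass), `g₁ = XWD + XM`, `g₂ = YWD + YM`,
`g₁₂ = XYWD + XYM`, the gate shifts `ĝx = L·g₁ − Px·R_G`, `ĝy = L·g₂ − Py·R_G` and the slacks `GM = L·g₁₂ − Py·g₁`,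
`GMp = L·g₁₂ − Px·g₂`, `GR1 = R_G·g₁₂ − g₁·g₂` of the three whole-lattice Ahlswede–Daykin facts AT THE GATE LAW
(`cg_fact_GM`, its mirror and `cg_fact_GR1` instantiated with `d'` in place of `d` — their hypotheses `d' ≤ c`, the
`(c, d')` law `gate_cd_law` (CoinChainXAGateCov) and the log-supermodularity of `d'` all follow from the chain's), the target is EXACTLY

  `T = L·(L·GM − Px·ĝy) = L·(L·GMp − Py·ĝx)`,   `R_G·(L·GM − Px·ĝy) = L²·GR1 + ĝx·ĝy`

— the identity-gate argument (`cg_identity_parts`) with the gate's `D'` parts in place of the surviving law's: `T ≥ 0`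
when `ĝy ≤ 0`, when `ĝx ≤ 0`, and when both are positive.  The identity gate is the case `d' = d`; the corner pair
`(j, m)` of g33's table is the NON-admissible member of this family (`d·1[j ∈ W]` on `D'`, `d` on `M`) and is false
(`cg_jm_corner_false`) — exactly because its gate law is not log-supermodular, so `GR1` fails for it.
-/

namespace Summit.Ventures.PercRepro2.Coin

open Classical

section MOpenGateParts

variable {R : Type*} [Field R] [LinearOrder R] [IsStrictOrderedRing R]

set_option maxHeartbeats 1600000 in
/-- **THE M-OPEN GATE IN THE PARTS**: `0 ≤ T` from the three whole-lattice facts at the gate law and the nonnegativity of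
the parts — the identities `T = L·(L·GM − Px·ĝy) = L·(L·GMp − Py·ĝx)`, `R_G·(L·GM − Px·ĝy) = L²·GR1 + ĝx·ĝy`. -/
theorem cg_mopen_parts (a δ u t XJ XU XM YJ YU YM XYM wD XWD YWD XYWD : R)
    (ha : 0 ≤ a) (hδ : 0 ≤ δ) (hu : 0 ≤ u) (ht : 0 ≤ t)
    (hXJ : 0 ≤ XJ) (hXU : 0 ≤ XU) (hXM : 0 ≤ XM) (hYJ : 0 ≤ YJ) (hYU : 0 ≤ YU) (hYM : 0 ≤ YM)
    (hwD : 0 ≤ wD)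
    (hGM : (XWD + XM) * (YJ + YU + YM) ≤ (a + δ + u + t) * (XYWD + XYM))
    (hGMp : (YWD + YM) * (XJ + XU + XM) ≤ (a + δ + u + t) * (XYWD + XYM))
    (hGR1 : (XWD + XM) * (YWD + YM) ≤ (a + wD + t) * (XYWD + XYM)) :
    0 ≤ ( a + δ + u + t ) * (( a + δ + u + t ) * ( a + δ + u + t ) * ( XYWD + XYM ) - ( a + δ + u + t ) * ( YJ + YU + YM ) * ( XWD + XM ) - ( a + δ + u + t ) * ( XJ + XU + XM ) * ( YWD + YM ) + ( XJ + XU + XM ) * ( YJ + YU + YM ) * ( a + wD + t )) - ((( a + δ + u + t ) * ( XU + XM ) - ( XJ + XU + XM ) * ( a + u + t )) * (( a + δ + u + t ) * ( YJ + YU + YM ) - ( YJ + YU + YM ) * ( a + δ + u + t )) + (( a + δ + u + t ) * ( YU + YM ) - ( YJ + YU + YM ) * ( a + u + t )) * (( a + δ + u + t ) * ( XJ + XU + XM ) - ( XJ + XU + XM ) * ( a + δ + u + t ))) := by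
  set L := a + δ + u + t with hL_def
  set RG := a + wD + t with hRG_def
  set Px := XJ + XU + XM with hPx_def
  set Py := YJ + YU + YM with hPy_def
  set gx := L * (XWD + XM) - Px * RG with hgx_def
  set gy := L * (YWD + YM) - Py * RG with hgy_def
  set GM := L * (XYWD + XYM) - Py * (XWD + XM) with hGM_def
  set GMp := L * (XYWD + XYM) - Px * (YWD + YM) with hGMp_def
  set GR1 := RG * (XYWD + XYM) - (XWD + XM) * (YWD + YM) with hGR1_def
  have hL : 0 ≤ L := by rw [hL_def]; linarith
  have hRG : 0 ≤ RG := by rw [hRG_def]; linarith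
  have hPx0 : 0 ≤ Px := by rw [hPx_def]; linarith
  have hPy0 : 0 ≤ Py := by rw [hPy_def]; linarith
  have hGM0 : 0 ≤ GM := by rw [hGM_def]; linarith
  have hGMp0 : 0 ≤ GMp := by rw [hGMp_def]; linarith
  have hGR10 : 0 ≤ GR1 := by rw [hGR1_def]; linarith
  have e1 : ( a + δ + u + t ) * (( a + δ + u + t ) * ( a + δ + u + t ) * ( XYWD + XYM ) - ( a + δ + u + t ) * ( YJ + YU + YM ) * ( XWD + XM ) - ( a + δ + u + t ) * ( XJ + XU + XM ) * ( YWD + YM ) + ( XJ + XU + XM ) * ( YJ + YU + YM ) * ( a + wD + t )) - ((( a + δ + u + t ) * ( XU + XM ) - ( XJ + XU + XM ) * ( a + u + t )) * (( a + δ + u + t ) * ( YJ + YU + YM ) - ( YJ + YU + YM ) * ( a + δ + u + t )) + (( a + δ + u + t ) * ( YU + YM ) - ( YJ + YU + YM ) * ( a + u + t )) * (( a + δ + u + t ) * ( XJ + XU + XM ) - ( XJ + XU + XM ) * ( a + δ + u + t ))) = L * (L * GM - Px * gy) := by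
    simp only [hGM_def, hgy_def, hL_def, hPx_def, hPy_def, hRG_def]; ring
  have e2 : L * (L * GM - Px * gy) = L * (L * GMp - Py * gx) := by
    simp only [hGM_def, hGMp_def, hgx_def, hgy_def, hL_def, hPx_def, hPy_def, hRG_def]; ring
  have e3 : RG * (L * GM - Px * gy) = L ^ 2 * GR1 + gx * gy := by
    simp only [hGM_def, hGR1_def, hgx_def, hgy_def, hL_def, hPx_def, hPy_def, hRG_def]; ring
  rw [e1]
  rcases le_or_gt gy 0 with hgy | hgy
  · exact mul_nonneg hL (by linarith [mul_nonneg hL hGM0, mul_nonneg hPx0 (neg_nonneg.2 hgy)])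
  rcases le_or_gt gx 0 with hgx | hgx
  · rw [e2]; exact mul_nonneg hL (by linarith [mul_nonneg hL hGMp0, mul_nonneg hPy0 (neg_nonneg.2 hgx)])
  have hpos : 0 < RG * (L * GM - Px * gy) := by
    rw [e3]; exact add_pos_of_nonneg_of_pos (mul_nonneg (sq_nonneg L) hGR10) (mul_pos hgx hgy)
  have hbr : 0 < L * GM - Px * gy := by
    rcases lt_or_eq_of_le hRG with hR | hR
    · exact (mul_pos_iff_of_pos_left hR).mp hpos
    · rw [← hR, zero_mul] at hpos; exact absurd hpos (lt_irrefl 0)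
  exact mul_nonneg hL hbr.le

end MOpenGateParts

section MOpenGateChain

variable {V : Type*} [DecidableEq V] {R : Type*} [Field R] [LinearOrder R] [IsStrictOrderedRing R]

set_option maxHeartbeats 4000000 in
/-- **EVERY M-OPEN ADMISSIBLE GATE IS A THEOREM OF THE CHAIN**: `ent = {m}`, ANY `ent' ∋ j, j'`, the entry markers, any
gate `d'` with `0 ≤ d' ≤ d`, `d'` log-supermodular, `d·d'`-monotone (`hdd'`) and `d' = d` on the `m`-clusters: the
cleared (XA′) holds (no log-supermodularity of `c`, no `hratio`).  Through the general-gate bridge, the facts `GM`, `GMp`,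
`GR1` at the gate law and `cg_mopen_parts`. -/
theorem chain_XA'_mopen_gate (U : Finset V) (m j j' : V) (ent' : Finset V) (ν c d d' : Finset V → R)
    (hj : j ∈ ent') (hj' : j' ∈ ent')
    (hν0 : ∀ W, 0 ≤ ν W) (hν : ∀ s ⊆ U, ∀ t ⊆ U, ν s * ν t ≤ ν (s ∩ t) * ν (s ∪ t))
    (hc0 : ∀ W, 0 ≤ c W) (hd0 : ∀ W, 0 ≤ d W) (hdc : ∀ W, d W ≤ c W)
    (hcd : ∀ s t, c s * d t ≤ c (s ∩ t) * d (s ∪ t))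
    (hd'0 : ∀ W, 0 ≤ d' W) (hd'd : ∀ W, d' W ≤ d W)
    (hd'd' : ∀ s t, d' s * d' t ≤ d' (s ∩ t) * d' (s ∪ t))
    (hdd' : ∀ s t, d s * d' t ≤ d (s ∩ t) * d' (s ∪ t))
    (hM : ∀ W, m ∈ W → d' W = d W)
    (x y : Finset V → R) (hx : ∀ W, x W = if j ∈ W then 1 else 0) (hy : ∀ W, y W = if j' ∈ W then 1 else 0) :
    (((∑ W ∈ U.powerset, ν W * chainMix {m} ent' 0 c d W) * (∑ W ∈ U.powerset, ν W * chainMix {m} ent' 1 c d W * x W) - (∑ W ∈ U.powerset, ν W * chainMix {m} ent' 0 c d W * x W) * (∑ W ∈ U.powerset, ν W * chainMix {m} ent' 1 c d W)) *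
          ((∑ W ∈ U.powerset, ν W * chainMix {m} ent' 0 c d W) * (∑ W ∈ U.powerset, ν W * chainMix {m} ent' 0 c d' W * y W) - (∑ W ∈ U.powerset, ν W * chainMix {m} ent' 0 c d W * y W) * (∑ W ∈ U.powerset, ν W * chainMix {m} ent' 0 c d' W))
        + ((∑ W ∈ U.powerset, ν W * chainMix {m} ent' 0 c d W) * (∑ W ∈ U.powerset, ν W * chainMix {m} ent' 1 c d W * y W) - (∑ W ∈ U.powerset, ν W * chainMix {m} ent' 0 c d W * y W) * (∑ W ∈ U.powerset, ν W * chainMix {m} ent' 1 c d W)) *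
          ((∑ W ∈ U.powerset, ν W * chainMix {m} ent' 0 c d W) * (∑ W ∈ U.powerset, ν W * chainMix {m} ent' 0 c d' W * x W) - (∑ W ∈ U.powerset, ν W * chainMix {m} ent' 0 c d W * x W) * (∑ W ∈ U.powerset, ν W * chainMix {m} ent' 0 c d' W))) ≤
        (∑ W ∈ U.powerset, ν W * chainMix {m} ent' 0 c d W) * ((∑ W ∈ U.powerset, ν W * chainMix {m} ent' 0 c d W) * (∑ W ∈ U.powerset, ν W * chainMix {m} ent' 0 c d W) * (∑ W ∈ U.powerset, ν W * chainMix {m} ent' 1 c d' W * (x W * y W))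
          - (∑ W ∈ U.powerset, ν W * chainMix {m} ent' 0 c d W) * (∑ W ∈ U.powerset, ν W * chainMix {m} ent' 0 c d W * y W) * (∑ W ∈ U.powerset, ν W * chainMix {m} ent' 1 c d' W * x W)
          - (∑ W ∈ U.powerset, ν W * chainMix {m} ent' 0 c d W) * (∑ W ∈ U.powerset, ν W * chainMix {m} ent' 0 c d W * x W) * (∑ W ∈ U.powerset, ν W * chainMix {m} ent' 1 c d' W * y W)
          + (∑ W ∈ U.powerset, ν W * chainMix {m} ent' 0 c d W * x W) * (∑ W ∈ U.powerset, ν W * chainMix {m} ent' 0 c d W * y W) * (∑ W ∈ U.powerset, ν W * chainMix {m} ent' 1 c d' W))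
 := by
  refine chain_XA'_gate_of_parts U m j j' ent' ν c d d' hj hj' x y hx hy ?_
  have hx0 : ∀ W, 0 ≤ x W := fun W => by rw [hx W]; split_ifs <;> norm_num
  have hy0 : ∀ W, 0 ≤ y W := fun W => by rw [hy W]; split_ifs <;> norm_num
  have hxm : ∀ s t, x s ≤ x (s ∪ t) := fun s t => by
    rw [hx s, hx (s ∪ t)]
    by_cases h : j ∈ s
    · rw [if_pos h, if_pos (Finset.mem_union_left t h)]
    · rw [if_neg h]; split_ifs <;> norm_num
  have hym : ∀ s t, y s ≤ y (s ∪ t) := fun s t => by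
    rw [hy s, hy (s ∪ t)]
    by_cases h : j' ∈ s
    · rw [if_pos h, if_pos (Finset.mem_union_left t h)]
    · rw [if_neg h]; split_ifs <;> norm_num
  have hxI : ∀ W, (¬ ∃ r ∈ ({m} : Finset V) ∪ ent', r ∈ W) → x W = 0 := fun W hW => by
    rw [hx W]; exact if_neg (fun h => hW ⟨j, Finset.mem_union.2 (Or.inr hj), h⟩)
  have hyI : ∀ W, (¬ ∃ r ∈ ({m} : Finset V) ∪ ent', r ∈ W) → y W = 0 := fun W hW => by
    rw [hy W]; exact if_neg (fun h => hW ⟨j', Finset.mem_union.2 (Or.inr hj'), h⟩)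
  have hcd0 : ∀ W, 0 ≤ c W - d W := fun W => by linarith [hdc W]
  have hd'c : ∀ W, d' W ≤ c W := fun W => le_trans (hd'd W) (hdc W)
  have hcd' : ∀ s t, c s * d' t ≤ c (s ∩ t) * d' (s ∪ t) := gate_cd_law c d d' hc0 hd0 hd'0 hd'd hcd hdd'
  -- the three facts at the gate law
  have FGM := cg_fact_GM U m ent' ν c d' hν0 hν hc0 hd'0 hd'c hcd' hd'd' x y hx0 hy0 hxm hym hxI hyI
  have FGMp := cg_fact_GM U m ent' ν c d' hν0 hν hc0 hd'0 hd'c hcd' hd'd' y x hy0 hx0 hym hxm hyI hxI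
  have FGR1 := cg_fact_GR1 U m ent' ν c d' hν0 hν hc0 hd'0 hd'c hcd' hd'd' x y hx0 hy0 hxm hym hxI hyI
  -- the gate law on the m-clusters is d
  have hMW : ∀ W ∈ U.powerset.filter (fun W => ∃ r ∈ ({m} : Finset V), r ∈ W), d' W = d W := fun W hW => by
    obtain ⟨r, hr, hrW⟩ := (Finset.mem_filter.1 hW).2
    exact hM W ((Finset.mem_singleton.1 hr) ▸ hrW)
  have eM0 : (∑ W ∈ U.powerset.filter (fun W => ∃ r ∈ ({m} : Finset V), r ∈ W), ν W * d' W) = ∑ W ∈ U.powerset.filter (fun W => ∃ r ∈ ({m} : Finset V), r ∈ W), ν W * d W :=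
    Finset.sum_congr rfl (fun W hW => by rw [hMW W hW])
  have eMx : (∑ W ∈ U.powerset.filter (fun W => ∃ r ∈ ({m} : Finset V), r ∈ W), ν W * d' W * x W) = ∑ W ∈ U.powerset.filter (fun W => ∃ r ∈ ({m} : Finset V), r ∈ W), ν W * d W * x W :=
    Finset.sum_congr rfl (fun W hW => by rw [hMW W hW])
  have eMy : (∑ W ∈ U.powerset.filter (fun W => ∃ r ∈ ({m} : Finset V), r ∈ W), ν W * d' W * y W) = ∑ W ∈ U.powerset.filter (fun W => ∃ r ∈ ({m} : Finset V), r ∈ W), ν W * d W * y W :=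
    Finset.sum_congr rfl (fun W hW => by rw [hMW W hW])
  have eMxy : (∑ W ∈ U.powerset.filter (fun W => ∃ r ∈ ({m} : Finset V), r ∈ W), ν W * d' W * (x W * y W)) = ∑ W ∈ U.powerset.filter (fun W => ∃ r ∈ ({m} : Finset V), r ∈ W), ν W * d W * (x W * y W) :=
    Finset.sum_congr rfl (fun W hW => by rw [hMW W hW])
  have eMyx : (∑ W ∈ U.powerset.filter (fun W => ∃ r ∈ ({m} : Finset V), r ∈ W), ν W * d' W * (y W * x W)) = ∑ W ∈ U.powerset.filter (fun W => ∃ r ∈ ({m} : Finset V), r ∈ W), ν W * d W * (x W * y W) :=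
    Finset.sum_congr rfl (fun W hW => by rw [hMW W hW]; ring)
  have eDyx : (∑ W ∈ U.powerset.filter (fun W => (¬ ∃ r ∈ ({m} : Finset V), r ∈ W) ∧ ∃ r ∈ ent', r ∈ W), ν W * d' W * (y W * x W)) = ∑ W ∈ U.powerset.filter (fun W => (¬ ∃ r ∈ ({m} : Finset V), r ∈ W) ∧ ∃ r ∈ ent', r ∈ W), ν W * d' W * (x W * y W) :=
    Finset.sum_congr rfl (fun W _ => by ring)
  -- the gate-killed and gate-surviving coin-entered sums of the facts add up to the c-sums, like the chain's
  have eK0 : (∑ W ∈ U.powerset.filter (fun W => ¬ ∃ r ∈ ({m} : Finset V) ∪ ent', r ∈ W), ν W * c W) + (∑ W ∈ U.powerset.filter (fun W => (¬ ∃ r ∈ ({m} : Finset V), r ∈ W) ∧ ∃ r ∈ ent', r ∈ W), ν W * (c W - d' W)) + (∑ W ∈ U.powerset.filter (fun W => (¬ ∃ r ∈ ({m} : Finset V), r ∈ W) ∧ ∃ r ∈ ent', r ∈ W), ν W * d' W)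
      = (∑ W ∈ U.powerset.filter (fun W => ¬ ∃ r ∈ ({m} : Finset V) ∪ ent', r ∈ W), ν W * c W) + (∑ W ∈ U.powerset.filter (fun W => (¬ ∃ r ∈ ({m} : Finset V), r ∈ W) ∧ ∃ r ∈ ent', r ∈ W), ν W * (c W - d W)) + (∑ W ∈ U.powerset.filter (fun W => (¬ ∃ r ∈ ({m} : Finset V), r ∈ W) ∧ ∃ r ∈ ent', r ∈ W), ν W * d W) := by
    rw [add_assoc, add_assoc, ← Finset.sum_add_distrib, ← Finset.sum_add_distrib]; congr 1; exact Finset.sum_congr rfl (fun W _ => by ring)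
  have eKx : (∑ W ∈ U.powerset.filter (fun W => (¬ ∃ r ∈ ({m} : Finset V), r ∈ W) ∧ ∃ r ∈ ent', r ∈ W), ν W * (c W - d' W) * x W) + (∑ W ∈ U.powerset.filter (fun W => (¬ ∃ r ∈ ({m} : Finset V), r ∈ W) ∧ ∃ r ∈ ent', r ∈ W), ν W * d' W * x W)
      = (∑ W ∈ U.powerset.filter (fun W => (¬ ∃ r ∈ ({m} : Finset V), r ∈ W) ∧ ∃ r ∈ ent', r ∈ W), ν W * (c W - d W) * x W) + (∑ W ∈ U.powerset.filter (fun W => (¬ ∃ r ∈ ({m} : Finset V), r ∈ W) ∧ ∃ r ∈ ent', r ∈ W), ν W * d W * x W) := by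
    rw [← Finset.sum_add_distrib, ← Finset.sum_add_distrib]; exact Finset.sum_congr rfl (fun W _ => by ring)
  have eKy : (∑ W ∈ U.powerset.filter (fun W => (¬ ∃ r ∈ ({m} : Finset V), r ∈ W) ∧ ∃ r ∈ ent', r ∈ W), ν W * (c W - d' W) * y W) + (∑ W ∈ U.powerset.filter (fun W => (¬ ∃ r ∈ ({m} : Finset V), r ∈ W) ∧ ∃ r ∈ ent', r ∈ W), ν W * d' W * y W)
      = (∑ W ∈ U.powerset.filter (fun W => (¬ ∃ r ∈ ({m} : Finset V), r ∈ W) ∧ ∃ r ∈ ent', r ∈ W), ν W * (c W - d W) * y W) + (∑ W ∈ U.powerset.filter (fun W => (¬ ∃ r ∈ ({m} : Finset V), r ∈ W) ∧ ∃ r ∈ ent', r ∈ W), ν W * d W * y W) := by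
    rw [← Finset.sum_add_distrib, ← Finset.sum_add_distrib]; exact Finset.sum_congr rfl (fun W _ => by ring)
  rw [eMx, eMy, eMxy, eM0, eK0, eKy] at FGM
  rw [eMy, eMx, eMyx, eDyx, eM0, eK0, eKx] at FGMp
  rw [eMx, eMy, eMxy, eM0] at FGR1
  rw [eM0, eMx, eMy, eMxy]
  exact cg_mopen_parts _ _ _ _ _ _ _ _ _ _ _ _ _ _ _
    (Finset.sum_nonneg (fun W _ => mul_nonneg (hν0 W) (hc0 W)))
    (Finset.sum_nonneg (fun W _ => mul_nonneg (hν0 W) (hcd0 W)))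
    (Finset.sum_nonneg (fun W _ => mul_nonneg (hν0 W) (hd0 W)))
    (Finset.sum_nonneg (fun W _ => mul_nonneg (hν0 W) (hd0 W)))
    (Finset.sum_nonneg (fun W _ => mul_nonneg (mul_nonneg (hν0 W) (hcd0 W)) (hx0 W)))
    (Finset.sum_nonneg (fun W _ => mul_nonneg (mul_nonneg (hν0 W) (hd0 W)) (hx0 W)))
    (Finset.sum_nonneg (fun W _ => mul_nonneg (mul_nonneg (hν0 W) (hd0 W)) (hx0 W)))
    (Finset.sum_nonneg (fun W _ => mul_nonneg (mul_nonneg (hν0 W) (hcd0 W)) (hy0 W)))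
    (Finset.sum_nonneg (fun W _ => mul_nonneg (mul_nonneg (hν0 W) (hd0 W)) (hy0 W)))
    (Finset.sum_nonneg (fun W _ => mul_nonneg (mul_nonneg (hν0 W) (hd0 W)) (hy0 W)))
    (Finset.sum_nonneg (fun W _ => mul_nonneg (hν0 W) (hd'0 W)))
    FGM FGMp FGR1

end MOpenGateChain

end Summit.Ventures.PercRepro2.Coin
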